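import Literature.Geometry.Riemannian.RicciDeTurckChartFamily
import Literature.Geometry.Lorentzian.CurvatureNaturality
import Literature.Geometry.Lorentzian.ChartMetricCoord
import Literature.Geometry.Lorentzian.DivergenceTheorem
import Literature.Geometry.Lorentzian.CoordDivergenceIdentity
import HarnessLib

/-!
# The Gauss curvature of a surface as a divergence

For a smooth Riemannian metric `g` on a `2`-manifold `M` and a smooth vector field `Y`, the
**normalized acceleration field** `(∇_Y Y − (div Y) Y)/g(Y, Y)` — for `Y ≠ 0` this is
`∇_V V − (div V) V` of the unit field `V = Y/|Y|` — has divergence equal to the Gauss curvature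
`K = S/2` wherever `Y ≠ 0` (`vectorDivergence_normalizedAcceleration`). This is Cartan's
structure equation `dω₁₂ = −K θ¹ ∧ θ²` for the orthonormal frame `(V, ⋆)` written in vector form:
it needs neither an orientation nor a coframe, and it is the local identity of the
Poincaré–Hopf route to the Gauss–Bonnet theorem (integrate over `M` minus small discs around the
zeros of `Y` with the divergence theorem `integral_vectorDivergence_eq_zero` of
`DivergenceTheorem.lean`; the boundary contributions are `2π` times the indices).

The identity itself is the coordinate theorem `MetricCoord.IsMetricOn.divAt_normalized`
(`CoordDivergenceIdentity.lean`); this file TRANSPORTS it to the manifold, reading everything in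
the chart at the point through the inverse extended chart `Φ = chartInv I x₁` as a local isometry
from the chart target (`chartPullback`, `RicciDeTurckNaturality.lean`):

* `leviCivita_eq_covDAt`, `vectorDivergence_eq_divAt` — on `U : Opens E` the covariant
  differential / divergence of the tree (`PseudoRiemannianMetric.leviCivita`,
  `vectorDivergence`) are `MetricCoord.covDAt` / `divAt` of the components
  (`OpensChart.leviCivita_apply_eq`, `christoffel_eq_chrAt`);
* `vectorRep I x₁ Y` — the representative `e ↦ D(extChartAt I x₁)(Y(φ⁻¹ e))` of a vector field
  (it is the pulled-back field, `mpullback_chartInv_apply`; smooth fields have smooth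
  representatives, `contDiffOn_vectorRep`); `metricRep I g x₁` — the components of `g` in the
  chart (`chartRep` of the constant family; `val_chartPullback_eq_metricRep`);
* the dictionary at `u` (with `x = Φ u`): `val_eq_metricRep` (`g_x(Y,Z) = Ĝ_u(Ŷ,Ẑ)`),
  `scalarCurvature_eq_scalAt_metricRep` (`S_g(x) = scalAt Ĝ u`, by `scalarCurvature_comap`),
  `vectorRep_leviCivita_self` (`(∇_Y Y)^ = covDAt Ĝ Ŷ (Ŷ)`, by
  `leviCivita_comap_mpullback_mpullback`), `vectorDivergence_eq_divAt_metricRep`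
  (`div_g Y (x) = divAt Ĝ Ŷ u`: the covariant differentials are conjugate by `dΦ_u`);
* `normalizedAcceleration g Y`, `vectorRep_normalizedAcceleration`, and the main theorem
  **`vectorDivergence_normalizedAcceleration`**: for `dim E = 2`, `g` Riemannian, `Y` smooth on
  the chart domain of `x` and `Y x ≠ 0`, `div_g(normalizedAcceleration g Y)(x) = S_g(x)/2`.

Everything is proved; the definitions `vectorRep`, `metricRep` (an abbreviation) and
`normalizedAcceleration` are explicit formulas; no statement of `Prop` type is introduced.

## References

* B. O'Neill, *Semi-Riemannian geometry with applications to relativity*, Academic Press 1983,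
  Ch. 3, Prop. 3.13 (coordinate formula for `D`), p. 86 (divergence), Prop. 3.59 (local
  isometries preserve the connection and the curvature). [ONeill1983]
* J. M. Lee, *Introduction to Riemannian Manifolds*, 2nd ed., Springer 2018, Cor. 8.28
  (`Rc = K g`, `S = 2K` on a `2`-manifold). [LeeRiemannianManifolds2018]
-/

noncomputable section

set_option maxSynthPendingDepth 3

open Bundle Set Function Filter FiberBundle VectorField ContinuousLinearMap TopologicalSpace
open scoped Manifold ContDiff Topology

namespace Literature.Geometry.Riemannian

open Lorentzian Lorentzian.OpensChart Lorentzian.PseudoRiemannianMetric Lorentzian.MetricCoord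

/-! ### On an open subset of the model space: the abstract objects are the coordinate ones -/

section Opens

variable {E : Type*} [NormedAddCommGroup E] [NormedSpace ℝ E] [FiniteDimensional ℝ E]
  [CompleteSpace E] {U : Opens E}
  {g : PseudoRiemannianMetric 𝓘(ℝ, E) ∞ E (TangentSpace 𝓘(ℝ, E) : U → Type _)}
  {G : E → E →L[ℝ] E →L[ℝ] ℝ} (hG : ∀ y : U, g.val y = G y)

include hG

omit [CompleteSpace E] in
/-- **The covariant differential of a metric on `U : Opens E` is `covDAt` of the components**:
for a vector field `W` on `U` with representative `Wf` differentiable at `x`,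
`∇W|_x = covDAt G Wf x` (`OpensChart.leviCivita_apply_eq`, `christoffel_eq_chrAt`, and the
symmetry of the Christoffel map). [cite: ONeill1983, Ch. 3, Prop. 3.13] -/
theorem leviCivita_eq_covDAt [g.HasLeviCivita] (x : U) {W : Π y : U, TangentSpace 𝓘(ℝ, E) y}
    {Wf : E → E} (hW : ∀ y : U, W y = Wf y) (hWd : DifferentiableAt ℝ Wf x) :
    (g.leviCivita W x : E →L[ℝ] E) = covDAt G Wf x := by
  ext X₀
  rw [Lorentzian.OpensChart.leviCivita_apply_eq hG x hW hWd X₀,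
    Lorentzian.OpensChart.christoffel_eq_chrAt hG x X₀ (W x), hW x]
  change fderiv ℝ Wf x X₀ + chrAt G x X₀ (Wf x) = covDAt G Wf x X₀
  rw [covDAt_apply, (isMetricOn_repr hG).chrAt_comm x.2]

omit [CompleteSpace E] in
/-- **The divergence of a metric on `U : Opens E` is `divAt` of the components.**
[cite: ONeill1983, Ch. 3, p. 86] -/
theorem vectorDivergence_eq_divAt [g.HasLeviCivita] (x : U)
    {W : Π y : U, TangentSpace 𝓘(ℝ, E) y} {Wf : E → E} (hW : ∀ y : U, W y = Wf y)
    (hWd : DifferentiableAt ℝ Wf x) :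
    g.vectorDivergence W x = divAt G Wf x := by
  rw [vectorDivergence_def, divAt_eq, traceCLM_apply, leviCivita_eq_covDAt hG x hW hWd]
  rfl

end Opens

section CoordCongr

variable {E : Type*} [NormedAddCommGroup E] [NormedSpace ℝ E] [FiniteDimensional ℝ E]
  {G : E → E →L[ℝ] E →L[ℝ] ℝ}

/-- `divAt` depends only on the germ of the field at the point. [folklore] -/
theorem _root_.Literature.Geometry.Lorentzian.MetricCoord.divAt_congr_of_eventuallyEq
    {Z Z' : E → E} {x : E} (h : Z =ᶠ[𝓝 x] Z') : divAt G Z x = divAt G Z' x := by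
  simp only [divAt_eq, covDAt, h.fderiv_eq, h.eq_of_nhds]

end CoordCongr

/-! ### Reading vector fields in a chart -/

section Chart

variable {E : Type*} [NormedAddCommGroup E] [NormedSpace ℝ E] {H : Type*} [TopologicalSpace H]
  {I : ModelWithCorners ℝ E H} [I.Boundaryless] {M : Type*} [TopologicalSpace M]
  [ChartedSpace H M] [IsManifold I ∞ M]

variable (I) in
/-- **The representative of a vector field in the chart at `x₁`**: the map `E → E`,
`e ↦ D(extChartAt I x₁)_{φ⁻¹ e} (Y (φ⁻¹ e))` (components of `Y` in the coordinate frame, read as a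
vector of the model space; junk off the chart target). O'Neill 1983, Ch. 1, Def. 1.9 ff.
(`V = ∑ V(xⁱ) ∂ᵢ`). [cite: ONeill1983, Ch. 1, Def. 1.9 ff] -/
def vectorRep (x₁ : M) (Y : Π x : M, TangentSpace I x) (e : E) : E :=
  mfderiv I 𝓘(ℝ, E) (extChartAt I x₁) ((extChartAt I x₁).symm e) (Y ((extChartAt I x₁).symm e))

omit [I.Boundaryless] [IsManifold I ∞ M] in
/-- Unfolding lemma for `vectorRep`. [folklore] -/
theorem vectorRep_apply (x₁ : M) (Y : Π x : M, TangentSpace I x) (e : E) :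
    vectorRep I x₁ Y e = mfderiv I 𝓘(ℝ, E) (extChartAt I x₁) ((extChartAt I x₁).symm e)
      (Y ((extChartAt I x₁).symm e)) := rfl

variable [FiniteDimensional ℝ E]

/-- The inverse of the differential of `chartInv` is the differential of the extended chart.
[folklore] -/
theorem inverse_mfderiv_chartInv (x₁ : M) (u : chartTarget I x₁) :
    (mfderiv 𝓘(ℝ, E) I (chartInv I x₁) u).inverse =
      mfderiv I 𝓘(ℝ, E) (extChartAt I x₁) (chartInv I x₁ u) := by
  have hinv : (mfderiv 𝓘(ℝ, E) I (chartInv I x₁) u).IsInvertible :=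
    isInvertible_mfderiv_of_injective rfl (injective_mfderiv_chartInv x₁ u)
  obtain ⟨e, he⟩ := hinv
  rw [← he, ContinuousLinearMap.inverse_equiv]
  have hcomp := mfderiv_extChartAt_comp_mfderiv_chartInv x₁ u
  rw [← he] at hcomp
  ext v
  have := DFunLike.congr_fun hcomp (e.symm v)
  simp only [ContinuousLinearMap.comp_apply, ContinuousLinearEquiv.coe_coe,
    ContinuousLinearEquiv.apply_symm_apply] at this
  exact this.symm

/-- **The pullback of a vector field along the inverse chart is its representative**:
`(Φ^* Y)_u = D(extChartAt I x₁)(Y (Φ u)) = vectorRep I x₁ Y u`. [folklore] -/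
theorem mpullback_chartInv_apply (x₁ : M) (Y : Π x : M, TangentSpace I x)
    (u : chartTarget I x₁) :
    (mpullback 𝓘(ℝ, E) I (chartInv I x₁) Y u : E) = vectorRep I x₁ Y u := by
  rw [mpullback_apply, inverse_mfderiv_chartInv]
  rfl

omit [I.Boundaryless] [FiniteDimensional ℝ E] in
/-- **Smooth vector fields have smooth representatives**: if `Y` is `C^∞` on the chart domain of
`x₁` then `vectorRep I x₁ Y` is `C^∞` on the chart target (Mathlib's
`Trivialization.contMDiffOn_section_iff` for the trivialization of `TM` at `x₁`, which reads
vectors through `D(extChartAt I x₁)`). [folklore] -/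
theorem contDiffOn_vectorRep (x₁ : M) {Y : Π x : M, TangentSpace I x}
    (hY : CMDiff[(chartAt H x₁).source] ∞ (T% Y)) :
    ContDiffOn ℝ ∞ (vectorRep I x₁ Y) (extChartAt I x₁).target := by
  set e := trivializationAt E (TangentSpace I : M → Type _) x₁ with he
  have hbase : (chartAt H x₁).source ⊆ e.baseSet := by simp [he]
  have h1 : ContMDiffOn I 𝓘(ℝ, E) ∞ (fun y ↦ (e ⟨y, Y y⟩).2) (chartAt H x₁).source :=
    (e.contMDiffOn_section_iff (chartAt H x₁).open_source hbase).1 hY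
  have h2 : ContMDiffOn 𝓘(ℝ, E) 𝓘(ℝ, E) ∞ ((fun y ↦ (e ⟨y, Y y⟩).2) ∘ (extChartAt I x₁).symm)
      (extChartAt I x₁).target :=
    h1.comp (contMDiffOn_extChartAt_symm x₁) fun z hz ↦ by
      rw [mem_preimage, ← _root_.extChartAt_source I]; exact (extChartAt I x₁).map_target hz
  rw [← contMDiffOn_iff_contDiffOn]
  refine h2.congr fun z hz ↦ ?_
  have hzs : (extChartAt I x₁).symm z ∈ (chartAt H x₁).source := by
    rw [← _root_.extChartAt_source I]; exact (extChartAt I x₁).map_target hz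
  simp only [Function.comp_apply, vectorRep_apply]
  exact (DFunLike.congr_fun (TangentBundle.continuousLinearMapAt_trivializationAt hzs)
    (Y _)).symm.trans (Trivialization.continuousLinearMapAt_apply_of_mem (R := ℝ) _ (hbase hzs) _)

variable [CompleteSpace E] (g : PseudoRiemannianMetric I ∞ E (TangentSpace I : M → Type _))

variable (I) in
/-- **The components of a metric in the chart at `x₁`** (`chartRep` of the constant family): on
the chart target the component map of the pulled-back metric `chartPullback I g x₁`
(`val_chartPullback_eq_metricRep`). [folklore] -/
abbrev metricRep (x₁ : M) : E → E →L[ℝ] E →L[ℝ] ℝ :=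
  chartRep I (fun _ ↦ g) x₁ 0

omit [CompleteSpace E] in
/-- The pulled-back metric on the chart target has components `metricRep`. [folklore] -/
theorem val_chartPullback_eq_metricRep (x₁ : M) (u : chartTarget I x₁) :
    (chartPullback I g x₁).val u = metricRep I g x₁ u :=
  val_chartPullback_eq_chartRep (fun _ ↦ g) x₁ 0 u

omit [CompleteSpace E] in
/-- **The metric in the chart**: `g_x(Y, Z) = Ĝ_u(Ŷ u, Ẑ u)` for `x = Φ u`. [folklore] -/
theorem val_eq_metricRep (x₁ : M) (Y Z : Π x : M, TangentSpace I x) (u : chartTarget I x₁) :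
    g.val (chartInv I x₁ u) (Y (chartInv I x₁ u)) (Z (chartInv I x₁ u)) =
      metricRep I g x₁ u (vectorRep I x₁ Y u) (vectorRep I x₁ Z u) := by
  rw [← val_comap_mpullback g contMDiff_pullbackBilin_holds (contMDiff_chartInv x₁)
    (injective_mfderiv_chartInv x₁) rfl Y Z u, ← mpullback_chartInv_apply,
    ← mpullback_chartInv_apply]
  exact DFunLike.congr_fun (DFunLike.congr_fun (val_chartPullback_eq_metricRep g x₁ u) _) _

variable [g.HasLeviCivita]

/-- **The scalar curvature in the chart**: `S_g(Φ u) = scalAt Ĝ u` (naturality of the scalar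
curvature under the local isometry `Φ`, `scalarCurvature_comap`, and
`scalarCurvature_eq_scalAt` on the chart target). [cite: ONeill1983, Ch. 3, Prop. 3.59 and Def. 3.53] -/
theorem scalarCurvature_eq_scalAt_metricRep (x₁ : M) (u : chartTarget I x₁) :
    g.scalarCurvature (chartInv I x₁ u) = scalAt (metricRep I g x₁) u := by
  haveI := (chartPullback I g x₁).hasLeviCivita
  rw [← g.scalarCurvature_comap contMDiff_pullbackBilin_holds (contMDiff_chartInv x₁)
    (injective_mfderiv_chartInv x₁) rfl u]
  exact OpensChart.scalarCurvature_eq_scalAt (val_chartPullback_eq_metricRep g x₁) u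

/-- **The covariant derivative `∇_Y Y` in the chart**: the representative of the field
`x ↦ ∇_{Y x} Y` at `u` is `covDAt Ĝ Ŷ u (Ŷ u)` (naturality of the Levi-Civita connection,
`leviCivita_comap_mpullback_mpullback`, and `leviCivita_eq_covDAt` on the chart target).
[cite: ONeill1983, Ch. 3, Prop. 3.59 and Prop. 3.13] -/
theorem vectorRep_leviCivita_self (x₁ : M) {Y : Π x : M, TangentSpace I x} (u : chartTarget I x₁)
    (hY : MDiffAt (T% Y) (chartInv I x₁ u))
    (hYf : DifferentiableAt ℝ (vectorRep I x₁ Y) u) :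
    vectorRep I x₁ (fun y ↦ g.leviCivita Y y (Y y)) u =
      covDAt (metricRep I g x₁) (vectorRep I x₁ Y) u (vectorRep I x₁ Y u) := by
  haveI := (chartPullback I g x₁).hasLeviCivita
  rw [← mpullback_chartInv_apply, ← g.leviCivita_comap_mpullback_mpullback
    contMDiff_pullbackBilin_holds (contMDiff_chartInv x₁) (injective_mfderiv_chartInv x₁) rfl hY]
  have h := leviCivita_eq_covDAt (val_chartPullback_eq_metricRep g x₁) u
    (W := mpullback 𝓘(ℝ, E) I (chartInv I x₁) Y) (fun y ↦ mpullback_chartInv_apply x₁ Y y) hYf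
  rw [mpullback_chartInv_apply x₁ Y u]
  exact DFunLike.congr_fun h (vectorRep I x₁ Y u)

/-- **The divergence in the chart**: `div_g Y (Φ u) = divAt Ĝ Ŷ u` (the covariant differential
of `Φ^* Y` is conjugate to that of `Y` by `dΦ_u`, so the traces agree; then
`vectorDivergence_eq_divAt` on the chart target). [cite: ONeill1983, Ch. 3, Prop. 3.59 and p. 86] -/
theorem vectorDivergence_eq_divAt_metricRep (x₁ : M) {Y : Π x : M, TangentSpace I x}
    (u : chartTarget I x₁) (hY : MDiffAt (T% Y) (chartInv I x₁ u))
    (hYf : DifferentiableAt ℝ (vectorRep I x₁ Y) u) :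
    g.vectorDivergence Y (chartInv I x₁ u) = divAt (metricRep I g x₁) (vectorRep I x₁ Y) u := by
  haveI := (chartPullback I g x₁).hasLeviCivita
  haveI : FiniteDimensional ℝ (TangentSpace I (chartInv I x₁ u)) :=
    inferInstanceAs (FiniteDimensional ℝ E)
  haveI : Module.Finite ℝ (TangentSpace 𝓘(ℝ, E) u) := inferInstanceAs (Module.Finite ℝ E)
  haveI : Module.Free ℝ (TangentSpace 𝓘(ℝ, E) u) := inferInstanceAs (Module.Free ℝ E)
  haveI : Module.Free ℝ (TangentSpace I (chartInv I x₁ u)) := inferInstanceAs (Module.Free ℝ E)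
  rw [← vectorDivergence_eq_divAt (val_chartPullback_eq_metricRep g x₁) u
    (W := mpullback 𝓘(ℝ, E) I (chartInv I x₁) Y) (fun y ↦ mpullback_chartInv_apply x₁ Y y) hYf]
  -- the two covariant differentials are conjugate by `dΦ_u`
  set e := mfderivEquivOfInjective (I := I) (I' := 𝓘(ℝ, E)) (chartInv I x₁) u
    (injective_mfderiv_chartInv x₁ u) rfl with hedef
  have hconj : ((chartPullback I g x₁).leviCivita (mpullback 𝓘(ℝ, E) I (chartInv I x₁) Y) u :
      TangentSpace 𝓘(ℝ, E) u →ₗ[ℝ] TangentSpace 𝓘(ℝ, E) u) = e.symm.toLinearMap ∘ₗ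
        (g.leviCivita Y (chartInv I x₁ u) : TangentSpace I (chartInv I x₁ u) →ₗ[ℝ]
          TangentSpace I (chartInv I x₁ u)) ∘ₗ e.toLinearMap := by
    refine LinearMap.ext fun v ↦ ?_
    simp only [LinearMap.coe_comp, Function.comp_apply, ContinuousLinearMap.coe_coe,
      LinearEquiv.coe_coe]
    rw [g.leviCivita_comap_mpullback_apply contMDiff_pullbackBilin_holds (contMDiff_chartInv x₁)
      (injective_mfderiv_chartInv x₁) rfl hY v]
    apply e.injective
    rw [LinearEquiv.apply_symm_apply, hedef, mfderivEquivOfInjective_apply,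
      ← ContinuousLinearMap.comp_apply,
      (isInvertible_mfderiv_of_injective rfl (injective_mfderiv_chartInv x₁ u)).self_comp_inverse]
    rfl
  rw [vectorDivergence_def, vectorDivergence_def, hconj, ← LinearMap.comp_assoc,
    LinearMap.trace_comp_comm', ← LinearMap.comp_assoc]
  simp

end Chart

/-! ### The curvature of a surface as a divergence -/

section Surface

variable {E : Type*} [NormedAddCommGroup E] [NormedSpace ℝ E] {H : Type*} [TopologicalSpace H]
  {I : ModelWithCorners ℝ E H} [I.Boundaryless] {M : Type*} [TopologicalSpace M]
  [ChartedSpace H M] [IsManifold I ∞ M] [FiniteDimensional ℝ E] [CompleteSpace E]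
  (g : PseudoRiemannianMetric I ∞ E (TangentSpace I : M → Type _)) [g.HasLeviCivita]

/-- The **normalized acceleration field** of a vector field `Y`:
`x ↦ (∇_{Y} Y − (div Y) Y) / g(Y, Y)` at `x` — for `Y ≠ 0` this is `∇_V V − (div V) V` for the
unit field `V = Y/|Y|` (junk value where `Y = 0`, since `0⁻¹ = 0`). Its divergence is the Gauss
curvature (`vectorDivergence_normalizedAcceleration`). [folklore] -/
def normalizedAcceleration (Y : Π x : M, TangentSpace I x) (x : M) : TangentSpace I x :=
  (g.val x (Y x) (Y x))⁻¹ • (g.leviCivita Y x (Y x) - g.vectorDivergence Y x • Y x)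

omit [I.Boundaryless] [FiniteDimensional ℝ E] [CompleteSpace E] in
/-- Unfolding lemma for `normalizedAcceleration`. [folklore] -/
theorem normalizedAcceleration_apply (Y : Π x : M, TangentSpace I x) (x : M) :
    normalizedAcceleration g Y x =
      (g.val x (Y x) (Y x))⁻¹ • (g.leviCivita Y x (Y x) - g.vectorDivergence Y x • Y x) := rfl

/-- **The representative of the normalized acceleration field** is the coordinate field of
`MetricCoord.IsMetricOn.divAt_normalized`: for `Y` smooth on the chart domain of `x₁` and `u` in
the chart target,
`vectorRep (normalizedAcceleration Y) u = (Ĝ(Ŷ,Ŷ))⁻¹ (covDAt Ĝ Ŷ u (Ŷ u) − divAt Ĝ Ŷ u • Ŷ u)`.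
[folklore] -/
theorem vectorRep_normalizedAcceleration (x₁ : M) {Y : Π x : M, TangentSpace I x}
    (hY : CMDiff[(chartAt H x₁).source] ∞ (T% Y)) (u : chartTarget I x₁) :
    vectorRep I x₁ (normalizedAcceleration g Y) u =
      (metricRep I g x₁ u (vectorRep I x₁ Y u) (vectorRep I x₁ Y u))⁻¹ •
        (covDAt (metricRep I g x₁) (vectorRep I x₁ Y) u (vectorRep I x₁ Y u) -
          divAt (metricRep I g x₁) (vectorRep I x₁ Y) u • vectorRep I x₁ Y u) := by
  have hx : chartInv I x₁ u ∈ (chartAt H x₁).source := chartInv_mem_source x₁ u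
  have hYd : MDiffAt (T% Y) (chartInv I x₁ u) :=
    ((hY _ hx).contMDiffAt ((chartAt H x₁).open_source.mem_nhds hx)).mdifferentiableAt (by simp)
  have hYf : DifferentiableAt ℝ (vectorRep I x₁ Y) u :=
    (((contDiffOn_vectorRep x₁ hY) u u.2).contDiffAt
      ((isOpen_extChartAt_target x₁).mem_nhds u.2)).differentiableAt (by simp)
  rw [vectorRep_apply]
  change mfderiv I 𝓘(ℝ, E) (extChartAt I x₁) (chartInv I x₁ u)
    (normalizedAcceleration g Y (chartInv I x₁ u)) = _
  rw [normalizedAcceleration_apply, map_smul, map_sub, map_smul,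
    val_eq_metricRep g x₁ Y Y u, vectorDivergence_eq_divAt_metricRep g x₁ u hYd hYf,
    ← vectorRep_leviCivita_self g x₁ u hYd hYf]
  rfl

/-- **The Gauss curvature of a surface is the divergence of the normalized acceleration field.**
For a smooth Riemannian metric `g` on a `2`-manifold `M` (model space of dimension two), a
vector field `Y` smooth near `x` with `Y x ≠ 0`:
`div( (∇_Y Y − (div Y) Y)/g(Y,Y) )(x) = S_g(x)/2 = K(x)` — Cartan's structure equation
`dω₁₂ = −K θ¹ ∧ θ²` for the frame `(Y/|Y|, ⋆)` in vector form, needing neither an orientation nor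
a coframe. Proof: read everything in the chart at `x` (`vectorRep_normalizedAcceleration`,
`vectorDivergence_eq_divAt_metricRep`, `scalarCurvature_eq_scalAt_metricRep`) and apply the
coordinate identity `MetricCoord.IsMetricOn.divAt_normalized`. (Lee 2018, Cor. 8.28 for
`Ric = Kg`; O'Neill 1983, Ch. 3, Prop. 3.37 ff.) [cite: LeeRiemannianManifolds2018, Cor. 8.28] -/
theorem vectorDivergence_normalizedAcceleration (h2 : Module.finrank ℝ E = 2) (hg : g.IsRiemannian)
    {Y : Π x : M, TangentSpace I x} {x : M} (hY : CMDiff[(chartAt H x).source] ∞ (T% Y))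
    (hx : Y x ≠ 0) :
    g.vectorDivergence (normalizedAcceleration g Y) x = g.scalarCurvature x / 2 := by
  -- the chart at `x`, `u₀ = φ x`, `Φ u₀ = x`
  set u₀ : chartTarget I x := ⟨extChartAt I x x, (extChartAt I x).map_source
    (mem_extChartAt_source x)⟩ with hu₀
  have hΦu₀ : chartInv I x u₀ = x := chartInv_extChartAt x (mem_chart_source H x)
  set Ĝ := metricRep I g x with hĜdef
  set Ŷ := vectorRep I x Y with hŶdef
  have hĜ : IsMetricOn Ĝ (chartTarget I x : Set E) :=
    isMetricOn_repr (val_chartPullback_eq_metricRep g x)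
  have hŶs : ContDiffOn ℝ ∞ Ŷ (chartTarget I x : Set E) := contDiffOn_vectorRep x hY
  -- the representative of the normalized acceleration and its differentiability
  set Xf : E → E := fun e ↦ (Ĝ e (Ŷ e) (Ŷ e))⁻¹ • (covDAt Ĝ Ŷ e (Ŷ e) - divAt Ĝ Ŷ e • Ŷ e)
    with hXf
  have hrep : ∀ u : chartTarget I x, vectorRep I x (normalizedAcceleration g Y) u = Xf u :=
    fun u ↦ vectorRep_normalizedAcceleration g x hY u
  have hq : Ĝ u₀ (Ŷ u₀) (Ŷ u₀) ≠ 0 := by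
    rw [hĜdef, hŶdef, ← val_eq_metricRep g x Y Y u₀, hΦu₀]
    exact (hg x (Y x) hx).ne'
  have hXfd : DifferentiableAt ℝ Xf u₀ := by
    have hZd : DifferentiableAt ℝ Ŷ u₀ :=
      ((hŶs u₀ u₀.2).contDiffAt (hĜ.mem_nhds u₀.2)).differentiableAt (by simp)
    refine ((hĜ.hasFDerivAt_apply_self u₀.2 hZd).differentiableAt.inv hq).smul ?_
    exact (hĜ.hasFDerivAt_covDAt_self u₀.2 hŶs).differentiableAt.sub
      ((hĜ.hasFDerivAt_divAt u₀.2 hŶs).differentiableAt.smul hZd)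
  -- the normalized acceleration is a differentiable section at `x`
  have hXd : MDiffAt (T% (normalizedAcceleration g Y)) x := by
    refine mdifferentiableAt_section_of_chartRepr x (mem_chart_source H x) (Wf := Xf) ?_ ?_
    · filter_upwards [(chartAt H x).open_source.mem_nhds (mem_chart_source H x)] with y hy
      have hys : y ∈ (extChartAt I x).source := by rwa [_root_.extChartAt_source]
      have hyt : extChartAt I x y ∈ (extChartAt I x).target := (extChartAt I x).map_source hys
      have h := hrep ⟨extChartAt I x y, hyt⟩
      rw [vectorRep_apply] at h
      have hyy : (extChartAt I x).symm (extChartAt I x y) = y := (extChartAt I x).left_inv hys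
      rw [hyy] at h
      exact h
    · exact hXfd
  -- read the divergence and the scalar curvature in the chart
  have heq : vectorRep I x (normalizedAcceleration g Y) =ᶠ[𝓝 (u₀ : E)] Xf := by
    filter_upwards [(isOpen_extChartAt_target x).mem_nhds u₀.2] with e he
    exact hrep ⟨e, he⟩
  have hXrepd : DifferentiableAt ℝ (vectorRep I x (normalizedAcceleration g Y)) u₀ :=
    hXfd.congr_of_eventuallyEq heq
  have hXd' : MDiffAt (T% (normalizedAcceleration g Y)) (chartInv I x u₀) := by
    rw [hΦu₀]; exact hXd
  have hdiv : g.vectorDivergence (normalizedAcceleration g Y) x = divAt Ĝ Xf u₀ := by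
    have h1 := vectorDivergence_eq_divAt_metricRep g x u₀ hXd' hXrepd
    rw [hΦu₀] at h1
    rw [h1, divAt_congr_of_eventuallyEq heq]
  have hscal : g.scalarCurvature x = scalAt Ĝ u₀ := by
    rw [← scalarCurvature_eq_scalAt_metricRep g x u₀, hΦu₀]
  rw [hdiv, hscal, hXf]
  exact hĜ.divAt_normalized u₀.2 h2 hŶs hq

end Surface

end Literature.Geometry.Riemannian

end
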